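import Literature.AnabelianGeometry.EtaleTheta.SettingModelTateTwistFamilyInvClauses
import HarnessLib

/-!
# The stage-2 («Tate shear») model of [EtTh] §1: the deck-sign clause (P14ii-cl) on the twist family is a PARITY
# (`η_m` carries it iff `m` is odd), and the JOINT census {Prop. 1.5 (iii) `Z`-law ∧ inversion clauses ∧ (P14ii-cl)}:
# on the line `j = 2` it holds for `η_{i−1}` iff `i` is EVEN (proof-only; census)

S. Mochizuki, *The étale theta function and its Frobenioid-theoretic manifestations*, Publ. RIMS **45** (2009) [EtTh], §1,
Prop. 1.4 (ii), PRIMS PDF p. 22 («Θ̈(−Ü) = −Θ̈(Ü)»); Prop. 1.5 (iii) p. 23 (the `Z`-law and the inversion clauses)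
[cite: MochizukiEtTh2009, Prop 1.5 (iii) p.23].  abc-iut cell, layer L2, seat abc-iut-L2-t12 (gen 11); row «TWIST-FAMILY@stage-2»,
file (D) = last (over (A) `SettingModelTateDeckIterates` p508449, (B) `SettingModelTateTwistFamilyProp15iii` p509127, (C)
`SettingModelTateTwistFamilyInvClauses`).  PROOF-ONLY: no definition, no instance, no `Prop` fact; everything BY NAME — gen 10's
p500679 (`conj_beta_inflTheta_logUdd`: `β·infl(log Ü) = infl(log Ü)·infl κ(−1)`; `mem_GtpYdd_or_mem_GtpYdd_beta_inv_mul`;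
`inl_b_mem_GtpY_not_mem_GtpYdd_modelχq`), abc-iut-w5-d095's `conj_inl_bPowGfp_etaDdχq` (`β` fixes `η̈♯`) and
`inflTheta_kumYdd_negOne_ne_one`, abc-iut-L2-t6's `kumYdd_toKddHat_ofSection_modelχq`, abc-iut-L6-t12's `ContH1.conj_eq_self_of_mem`,
(B)'s `prop15iii_etaDdTwistPow_iff` / `prop15iii_etaDdTwistPow_line`, (C)'s `invClauses_etaDdTwistPow_recentredLine`.

THE RECORD: p491944 (the UNtwisted class fails (P14ii-cl) at every `modelχq p i j`), p500679 (the single twist carries it),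
p501580 / p505869 (joint instance at `(2, 2)`).  THIS FILE (numbers, not a side) — at `modelχq p i j` (every `p`, `i`, even `j`,
`m`, section `s`, `hC`), `η_m = η̈♯ · infl(log Ü)^m`:
* `conj_etaDdTwistPow_of_not_mem_GtpYdd` — every `ε ∈ Π^tp_Y ∖ Π^tp_Ÿ` acts by `η_m ↦ infl κ(−1)^m · η_m`; `infl κ(−1)² = 1 ≠ infl κ(−1)`;
* **`hdeck_etaDdTwistPow_iff_odd`** — the class-level deck-sign clause (P14ii-cl) for `E_s(η_m)` holds IFF `m` is ODD;
* **`exists_prop15iii_invClauses_hdeck_modelχq_line`** (`i` EVEN, `j = 2`) — JOINT ∃ {`Prop15iii` ∧ `InvClauses (ι_{1−i})` ∧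
  (P14ii-cl)} at ONE datum (`η_{i−1}`; gen 10 = `i = 2`), root form `ThetaSetting.exists_isEtThOrigin_prop15iii_invClauses_hdeck_line`;
  for EVERY `i`: `exists_prop15iii_invClauses_modelχq_line` (the first two jointly);
* **`not_hdeck_of_prop15iii_etaDdTwistPow_of_odd`** (`i` ODD, any `j`, `m`) — a member of the twist family satisfying the typed
  Prop. 1.5 (iii) FAILS (P14ii-cl); and the census **`exists_twistPow_prop15iii_and_hdeck_iff`**: some `η_m` carries
  {`Prop15iii` ∧ (P14ii-cl)} at `modelχq p i j` IFF `j = 2 ∧ i` even.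
HONEST FRAMING: SEMI-SYNTHETIC model — consistency / sharpness evidence for the typed interface ONLY; the twist family and the
parity are artefacts of this cell's model, not statements of print; [EtTh] is refereed and nothing of it is disputed or asserted;
typed ≠ proved; inhabited-at-a-model ≠ proved; no side taken on [IUTchIII] Cor. 3.12.
-/

noncomputable section

namespace Literature.AnabelianGeometry.EtaleTheta.SettingModel

open Literature.AnabelianGeometry.SemiGraphs Literature.AnabelianGeometry.AbsoluteAnabelian

variable (p : ℕ) [Fact p.Prime] (i j : ℤ) (hj : Even j)

/-! ### Parity of the deck sign on the twist family (every `(i, j)`) -/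

/-- An element of square `1` has `m`-th power `1` for even `m`. [folklore] -/
private theorem zpow_eq_one_of_sq_eq_one_of_even {M : Type*} [Group M] {c : M} (hc : c ^ 2 = 1) {m : ℤ} (hm : Even m) :
    c ^ m = 1 := by
  obtain ⟨r, rfl⟩ := hm
  rw [← two_mul, zpow_mul, zpow_ofNat, hc, one_zpow]

/-- An element of square `1` has `m`-th power itself for odd `m`. [folklore] -/
private theorem zpow_eq_self_of_sq_eq_one_of_odd {M : Type*} [Group M] {c : M} (hc : c ^ 2 = 1) {m : ℤ} (hm : Odd m) :
    c ^ m = c := by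
  obtain ⟨r, rfl⟩ := hm
  rw [zpow_add, zpow_one, zpow_mul, zpow_ofNat, hc, one_zpow, one_mul]

/-- **`infl κ(−1)² = 1`** in `H¹(Π^tp_Ÿ, Δ_Θ)` for any Kummer datum over `modelχq p i j` (`(−1)² = 1` in `O^×_K̈`).
[cite: MochizukiEtTh2009, Prop 1.4 (ii) p.22] -/
theorem inflTheta_kumYdd_negOne_sq (E : (ThetaSetting.modelχq p i j hj).KummerData) :
    (ThetaSetting.modelχq p i j hj).inflTheta (ThetaSetting.modelχq p i j hj).GtpYdd (E.kumYdd (E.toKddHat (-1))) ^ 2 = 1 := by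
  rw [← map_pow, ← map_pow, ← map_pow, neg_one_sq, map_one, map_one, map_one]

/-- **Every `ε ∈ Π^tp_Y ∖ Π^tp_Ÿ` acts on the twisted class by `η_m ↦ infl κ(−1)^m · η_m`** at `modelχq p i j` (every `i`, even
`j`, every `m`): `ε = β·y` with `y ∈ Π^tp_Ÿ` acting trivially, `β` fixing `η̈♯` and multiplying `infl(log Ü)` by `infl κ(−1)` (p500679).
[cite: MochizukiEtTh2009, Prop 1.4 (ii) p.22] -/
theorem conj_etaDdTwistPow_of_not_mem_GtpYdd (hC : (ThetaSetting.modelχq p i j hj).Compat) (m : ℤ) {ε : PiTpχq p i j}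
    (hε : ε ∈ (ThetaSetting.modelχq p i j hj).GtpY) (hε' : ε ∉ (ThetaSetting.modelχq p i j hj).GtpYdd) :
    haveI := hC.GtpYdd_normal
    ContH1.conj (ThetaSetting.modelχq p i j hj).toTheta (ThetaSetting.modelχq p i j hj).DeltaTheta ε
        (etaDdχq p i j hj *
          (ThetaSetting.modelχq p i j hj).inflTheta (ThetaSetting.modelχq p i j hj).GtpYdd (kummerCoreχq p i j hj).logUdd ^ m) =
      (ThetaSetting.modelχq p i j hj).inflTheta (ThetaSetting.modelχq p i j hj).GtpYdd
          ((kummerCoreχq p i j hj).toKummerData.kumYdd ((kummerCoreχq p i j hj).toKummerData.toKddHat (-1))) ^ m *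
        (etaDdχq p i j hj *
          (ThetaSetting.modelχq p i j hj).inflTheta (ThetaSetting.modelχq p i j hj).GtpYdd (kummerCoreχq p i j hj).logUdd ^ m) := by
  haveI := hC.GtpYdd_normal
  rcases mem_GtpYdd_or_mem_GtpYdd_beta_inv_mul p i j hj hC hε with h | h
  · exact absurd h hε'
  · have hεeq : ε = SemidirectProduct.inl (bPowGfp (iotaZ (Multiplicative.ofAdd 1))) *
        ((SemidirectProduct.inl (bPowGfp (iotaZ (Multiplicative.ofAdd 1))) : PiTpχq p i j)⁻¹ * ε) := by
      rw [mul_inv_cancel_left]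
    conv_lhs => rw [hεeq]
    rw [ContH1.conj_mul_apply, ContH1.conj_eq_self_of_mem _ h _, map_mul, map_zpow, conj_inl_bPowGfp_etaDdχq p i j hj hC,
      conj_beta_inflTheta_logUdd p i j hj hC, mul_zpow, mul_comm (_ ^ m) ((etaDdχq p i j hj) * _), mul_assoc]

/-- The hdeck right-hand side for the section datum is the core's `infl κ(−1)` (abc-iut-L2-t6's identification of the section
datum's Kummer classes with the core's). [cite: MochizukiEtTh2009, Prop 1.4 (ii) p.22] -/
theorem inflTheta_kumYdd_negOne_ofSection (s : GQp p →* PiTpχq p i j) (hs : Continuous s)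
    (hsec : ∀ σ : GQp p, (ThetaSetting.modelχq p i j hj).aug (s σ) = σ)
    (hsY : (ThetaSetting.modelχq p i j hj).GK.map s ≤ (ThetaSetting.modelχq p i j hj).GtpY)
    (hsYdd : (ThetaSetting.modelχq p i j hj).GKdd.map s ≤ (ThetaSetting.modelχq p i j hj).GtpYdd) :
    (ThetaSetting.modelχq p i j hj).inflTheta (ThetaSetting.modelχq p i j hj).GtpYdd
        (((kummerCoreχq p i j hj).toKummerDataOfSection s hs hsec hsY hsYdd).kumYdd
          (((kummerCoreχq p i j hj).toKummerDataOfSection s hs hsec hsY hsYdd).toKddHat (-1))) =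
      (ThetaSetting.modelχq p i j hj).inflTheta (ThetaSetting.modelχq p i j hj).GtpYdd
        ((kummerCoreχq p i j hj).toKummerData.kumYdd ((kummerCoreχq p i j hj).toKummerData.toKddHat (-1))) := by
  rw [kumYdd_toKddHat_ofSection_modelχq p i j hj s hs hsec hsY hsYdd]

section OfSection

variable (hC : (ThetaSetting.modelχq p i j hj).Compat) (s : GQp p →* PiTpχq p i j) (hs : Continuous s)
  (hsec : ∀ σ : GQp p, (ThetaSetting.modelχq p i j hj).aug (s σ) = σ)
  (hsY : (ThetaSetting.modelχq p i j hj).GK.map s ≤ (ThetaSetting.modelχq p i j hj).GtpY)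
  (hsYdd : (ThetaSetting.modelχq p i j hj).GKdd.map s ≤ (ThetaSetting.modelχq p i j hj).GtpYdd)

include hC in
/-- **(P14ii-cl) HOLDS for `E_s(η_m)` when `m` is ODD** (`infl κ(−1)^m = infl κ(−1)`; p500679 = `m = 1`).
[cite: MochizukiEtTh2009, Prop 1.4 (ii) p.22] -/
theorem hdeck_etaDdTwistPow_of_odd {m : ℤ} (hm : Odd m) :
    haveI := hC.GtpYdd_normal
    ∀ ε : PiTpχq p i j, ε ∈ (ThetaSetting.modelχq p i j hj).GtpY → ε ∉ (ThetaSetting.modelχq p i j hj).GtpYdd →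
      ContH1.conj (ThetaSetting.modelχq p i j hj).toTheta (ThetaSetting.modelχq p i j hj).DeltaTheta ε
          (((kummerCoreχq p i j hj).toKummerDataOfSection s hs hsec hsY hsYdd).etaleThetaDataOfClass
            (etaDdχq p i j hj *
              (ThetaSetting.modelχq p i j hj).inflTheta (ThetaSetting.modelχq p i j hj).GtpYdd
                (kummerCoreχq p i j hj).logUdd ^ m)).etaDd =
        (ThetaSetting.modelχq p i j hj).inflTheta (ThetaSetting.modelχq p i j hj).GtpYdd
            ((((kummerCoreχq p i j hj).toKummerDataOfSection s hs hsec hsY hsYdd).etaleThetaDataOfClass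
              (etaDdχq p i j hj *
                (ThetaSetting.modelχq p i j hj).inflTheta (ThetaSetting.modelχq p i j hj).GtpYdd
                  (kummerCoreχq p i j hj).logUdd ^ m)).kumYdd
              ((((kummerCoreχq p i j hj).toKummerDataOfSection s hs hsec hsY hsYdd).etaleThetaDataOfClass
                (etaDdχq p i j hj *
                  (ThetaSetting.modelχq p i j hj).inflTheta (ThetaSetting.modelχq p i j hj).GtpYdd
                    (kummerCoreχq p i j hj).logUdd ^ m)).toKddHat (-1))) *
          (((kummerCoreχq p i j hj).toKummerDataOfSection s hs hsec hsY hsYdd).etaleThetaDataOfClass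
            (etaDdχq p i j hj *
              (ThetaSetting.modelχq p i j hj).inflTheta (ThetaSetting.modelχq p i j hj).GtpYdd
                (kummerCoreχq p i j hj).logUdd ^ m)).etaDd := by
  haveI := hC.GtpYdd_normal
  intro ε hε hε'
  change ContH1.conj _ _ ε (etaDdχq p i j hj *
      (ThetaSetting.modelχq p i j hj).inflTheta (ThetaSetting.modelχq p i j hj).GtpYdd (kummerCoreχq p i j hj).logUdd ^ m) =
    (ThetaSetting.modelχq p i j hj).inflTheta (ThetaSetting.modelχq p i j hj).GtpYdd
      (((kummerCoreχq p i j hj).toKummerDataOfSection s hs hsec hsY hsYdd).kumYdd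
        (((kummerCoreχq p i j hj).toKummerDataOfSection s hs hsec hsY hsYdd).toKddHat (-1))) *
      (etaDdχq p i j hj *
        (ThetaSetting.modelχq p i j hj).inflTheta (ThetaSetting.modelχq p i j hj).GtpYdd (kummerCoreχq p i j hj).logUdd ^ m)
  rw [inflTheta_kumYdd_negOne_ofSection p i j hj s hs hsec hsY hsYdd, conj_etaDdTwistPow_of_not_mem_GtpYdd p i j hj hC m hε hε',
    zpow_eq_self_of_sq_eq_one_of_odd (inflTheta_kumYdd_negOne_sq p i j hj _) hm]

include hC in
/-- **(P14ii-cl) FAILS for `E_s(η_m)` when `m` is EVEN**: the deck element `β ∈ Π^tp_Y ∖ Π^tp_Ÿ` FIXES `η_m` (`infl κ(−1)^m = 1`), while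
the clause demands the factor `infl κ(−1) ≠ 1` (p491944 = `m = 0`). [cite: MochizukiEtTh2009, Prop 1.4 (ii) p.22] -/
theorem not_hdeck_etaDdTwistPow_of_even {m : ℤ} (hm : Even m) :
    haveI := hC.GtpYdd_normal
    ¬ ∀ ε : PiTpχq p i j, ε ∈ (ThetaSetting.modelχq p i j hj).GtpY → ε ∉ (ThetaSetting.modelχq p i j hj).GtpYdd →
      ContH1.conj (ThetaSetting.modelχq p i j hj).toTheta (ThetaSetting.modelχq p i j hj).DeltaTheta ε
          (((kummerCoreχq p i j hj).toKummerDataOfSection s hs hsec hsY hsYdd).etaleThetaDataOfClass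
            (etaDdχq p i j hj *
              (ThetaSetting.modelχq p i j hj).inflTheta (ThetaSetting.modelχq p i j hj).GtpYdd
                (kummerCoreχq p i j hj).logUdd ^ m)).etaDd =
        (ThetaSetting.modelχq p i j hj).inflTheta (ThetaSetting.modelχq p i j hj).GtpYdd
            ((((kummerCoreχq p i j hj).toKummerDataOfSection s hs hsec hsY hsYdd).etaleThetaDataOfClass
              (etaDdχq p i j hj *
                (ThetaSetting.modelχq p i j hj).inflTheta (ThetaSetting.modelχq p i j hj).GtpYdd
                  (kummerCoreχq p i j hj).logUdd ^ m)).kumYdd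
              ((((kummerCoreχq p i j hj).toKummerDataOfSection s hs hsec hsY hsYdd).etaleThetaDataOfClass
                (etaDdχq p i j hj *
                  (ThetaSetting.modelχq p i j hj).inflTheta (ThetaSetting.modelχq p i j hj).GtpYdd
                    (kummerCoreχq p i j hj).logUdd ^ m)).toKddHat (-1))) *
          (((kummerCoreχq p i j hj).toKummerDataOfSection s hs hsec hsY hsYdd).etaleThetaDataOfClass
            (etaDdχq p i j hj *
              (ThetaSetting.modelχq p i j hj).inflTheta (ThetaSetting.modelχq p i j hj).GtpYdd
                (kummerCoreχq p i j hj).logUdd ^ m)).etaDd := by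
  haveI := hC.GtpYdd_normal
  intro h
  have hβ := inl_b_mem_GtpY_not_mem_GtpYdd_modelχq p i j hj
  have key := h _ hβ.1 hβ.2
  change ContH1.conj _ _ _ (etaDdχq p i j hj *
      (ThetaSetting.modelχq p i j hj).inflTheta (ThetaSetting.modelχq p i j hj).GtpYdd (kummerCoreχq p i j hj).logUdd ^ m) =
    (ThetaSetting.modelχq p i j hj).inflTheta (ThetaSetting.modelχq p i j hj).GtpYdd
      (((kummerCoreχq p i j hj).toKummerDataOfSection s hs hsec hsY hsYdd).kumYdd
        (((kummerCoreχq p i j hj).toKummerDataOfSection s hs hsec hsY hsYdd).toKddHat (-1))) *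
      (etaDdχq p i j hj *
        (ThetaSetting.modelχq p i j hj).inflTheta (ThetaSetting.modelχq p i j hj).GtpYdd (kummerCoreχq p i j hj).logUdd ^ m) at key
  rw [inflTheta_kumYdd_negOne_ofSection p i j hj s hs hsec hsY hsYdd,
    conj_etaDdTwistPow_of_not_mem_GtpYdd p i j hj hC m hβ.1 hβ.2,
    zpow_eq_one_of_sq_eq_one_of_even (inflTheta_kumYdd_negOne_sq p i j hj _) hm, one_mul] at key
  exact inflTheta_kumYdd_negOne_ne_one p i j hj (kummerCoreχq p i j hj).toKummerData
    (mul_right_cancel (key.symm.trans (one_mul _).symm))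

include hC in
/-- **THE PARITY: (P14ii-cl) for `E_s(η_m)` at `modelχq p i j` ⟺ `m` odd** (every `p`, `i`, even `j`, `m`, section `s`).
[cite: MochizukiEtTh2009, Prop 1.4 (ii) p.22] -/
theorem hdeck_etaDdTwistPow_iff_odd (m : ℤ) :
    haveI := hC.GtpYdd_normal
    (∀ ε : PiTpχq p i j, ε ∈ (ThetaSetting.modelχq p i j hj).GtpY → ε ∉ (ThetaSetting.modelχq p i j hj).GtpYdd →
      ContH1.conj (ThetaSetting.modelχq p i j hj).toTheta (ThetaSetting.modelχq p i j hj).DeltaTheta ε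
          (((kummerCoreχq p i j hj).toKummerDataOfSection s hs hsec hsY hsYdd).etaleThetaDataOfClass
            (etaDdχq p i j hj *
              (ThetaSetting.modelχq p i j hj).inflTheta (ThetaSetting.modelχq p i j hj).GtpYdd
                (kummerCoreχq p i j hj).logUdd ^ m)).etaDd =
        (ThetaSetting.modelχq p i j hj).inflTheta (ThetaSetting.modelχq p i j hj).GtpYdd
            ((((kummerCoreχq p i j hj).toKummerDataOfSection s hs hsec hsY hsYdd).etaleThetaDataOfClass
              (etaDdχq p i j hj *
                (ThetaSetting.modelχq p i j hj).inflTheta (ThetaSetting.modelχq p i j hj).GtpYdd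
                  (kummerCoreχq p i j hj).logUdd ^ m)).kumYdd
              ((((kummerCoreχq p i j hj).toKummerDataOfSection s hs hsec hsY hsYdd).etaleThetaDataOfClass
                (etaDdχq p i j hj *
                  (ThetaSetting.modelχq p i j hj).inflTheta (ThetaSetting.modelχq p i j hj).GtpYdd
                    (kummerCoreχq p i j hj).logUdd ^ m)).toKddHat (-1))) *
          (((kummerCoreχq p i j hj).toKummerDataOfSection s hs hsec hsY hsYdd).etaleThetaDataOfClass
            (etaDdχq p i j hj *
              (ThetaSetting.modelχq p i j hj).inflTheta (ThetaSetting.modelχq p i j hj).GtpYdd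
                (kummerCoreχq p i j hj).logUdd ^ m)).etaDd) ↔ Odd m := by
  refine ⟨fun h => ?_, hdeck_etaDdTwistPow_of_odd p i j hj hC s hs hsec hsY hsYdd⟩
  by_contra hm
  exact not_hdeck_etaDdTwistPow_of_even p i j hj hC s hs hsec hsY hsYdd (Int.not_odd_iff_even.mp hm) h

include hC in
/-- **For ODD `i` no member of the twist family carries {Prop. 1.5 (iii) ∧ (P14ii-cl)}** at `modelχq p i j` (any even `j`, any `m`,
any section): `Prop15iii` pins `j = 2`, `m = i − 1` ((B)), which is EVEN. [cite: MochizukiEtTh2009, Prop 1.5 (iii) p.23] -/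
theorem not_hdeck_of_prop15iii_etaDdTwistPow_of_odd (hi : Odd i) (m : ℤ)
    (h15 : ThetaSetting.Prop15iii
      (((kummerCoreχq p i j hj).toKummerDataOfSection s hs hsec hsY hsYdd).etaleThetaDataOfClass
        (etaDdχq p i j hj *
          (ThetaSetting.modelχq p i j hj).inflTheta (ThetaSetting.modelχq p i j hj).GtpYdd
            (kummerCoreχq p i j hj).logUdd ^ m)) hC) :
    haveI := hC.GtpYdd_normal
    ¬ ∀ ε : PiTpχq p i j, ε ∈ (ThetaSetting.modelχq p i j hj).GtpY → ε ∉ (ThetaSetting.modelχq p i j hj).GtpYdd →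
      ContH1.conj (ThetaSetting.modelχq p i j hj).toTheta (ThetaSetting.modelχq p i j hj).DeltaTheta ε
          (((kummerCoreχq p i j hj).toKummerDataOfSection s hs hsec hsY hsYdd).etaleThetaDataOfClass
            (etaDdχq p i j hj *
              (ThetaSetting.modelχq p i j hj).inflTheta (ThetaSetting.modelχq p i j hj).GtpYdd
                (kummerCoreχq p i j hj).logUdd ^ m)).etaDd =
        (ThetaSetting.modelχq p i j hj).inflTheta (ThetaSetting.modelχq p i j hj).GtpYdd
            ((((kummerCoreχq p i j hj).toKummerDataOfSection s hs hsec hsY hsYdd).etaleThetaDataOfClass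
              (etaDdχq p i j hj *
                (ThetaSetting.modelχq p i j hj).inflTheta (ThetaSetting.modelχq p i j hj).GtpYdd
                  (kummerCoreχq p i j hj).logUdd ^ m)).kumYdd
              ((((kummerCoreχq p i j hj).toKummerDataOfSection s hs hsec hsY hsYdd).etaleThetaDataOfClass
                (etaDdχq p i j hj *
                  (ThetaSetting.modelχq p i j hj).inflTheta (ThetaSetting.modelχq p i j hj).GtpYdd
                    (kummerCoreχq p i j hj).logUdd ^ m)).toKddHat (-1))) *
          (((kummerCoreχq p i j hj).toKummerDataOfSection s hs hsec hsY hsYdd).etaleThetaDataOfClass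
            (etaDdχq p i j hj *
              (ThetaSetting.modelχq p i j hj).inflTheta (ThetaSetting.modelχq p i j hj).GtpYdd
                (kummerCoreχq p i j hj).logUdd ^ m)).etaDd := by
  obtain ⟨-, rfl⟩ := (prop15iii_etaDdTwistPow_iff p i j hj s hs hsec hsY hsYdd hC m).mp h15
  refine not_hdeck_etaDdTwistPow_of_even p i j hj hC s hs hsec hsY hsYdd ?_
  obtain ⟨r, rfl⟩ := hi
  exact ⟨r, by ring⟩

include hC in
/-- **CENSUS: some member `η_m` of the twist family carries {Prop. 1.5 (iii) `Z`-law ∧ (P14ii-cl)} at `modelχq p i j` IFF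
`j = 2 ∧ i` is even** (then `m = i − 1`). [cite: MochizukiEtTh2009, Prop 1.5 (iii) p.23] -/
theorem exists_twistPow_prop15iii_and_hdeck_iff :
    haveI := hC.GtpYdd_normal
    (∃ m : ℤ, ThetaSetting.Prop15iii
        (((kummerCoreχq p i j hj).toKummerDataOfSection s hs hsec hsY hsYdd).etaleThetaDataOfClass
          (etaDdχq p i j hj *
            (ThetaSetting.modelχq p i j hj).inflTheta (ThetaSetting.modelχq p i j hj).GtpYdd
              (kummerCoreχq p i j hj).logUdd ^ m)) hC ∧
      ∀ ε : PiTpχq p i j, ε ∈ (ThetaSetting.modelχq p i j hj).GtpY → ε ∉ (ThetaSetting.modelχq p i j hj).GtpYdd →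
        ContH1.conj (ThetaSetting.modelχq p i j hj).toTheta (ThetaSetting.modelχq p i j hj).DeltaTheta ε
            (((kummerCoreχq p i j hj).toKummerDataOfSection s hs hsec hsY hsYdd).etaleThetaDataOfClass
              (etaDdχq p i j hj *
                (ThetaSetting.modelχq p i j hj).inflTheta (ThetaSetting.modelχq p i j hj).GtpYdd
                  (kummerCoreχq p i j hj).logUdd ^ m)).etaDd =
          (ThetaSetting.modelχq p i j hj).inflTheta (ThetaSetting.modelχq p i j hj).GtpYdd
              ((((kummerCoreχq p i j hj).toKummerDataOfSection s hs hsec hsY hsYdd).etaleThetaDataOfClass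
                (etaDdχq p i j hj *
                  (ThetaSetting.modelχq p i j hj).inflTheta (ThetaSetting.modelχq p i j hj).GtpYdd
                    (kummerCoreχq p i j hj).logUdd ^ m)).kumYdd
                ((((kummerCoreχq p i j hj).toKummerDataOfSection s hs hsec hsY hsYdd).etaleThetaDataOfClass
                  (etaDdχq p i j hj *
                    (ThetaSetting.modelχq p i j hj).inflTheta (ThetaSetting.modelχq p i j hj).GtpYdd
                      (kummerCoreχq p i j hj).logUdd ^ m)).toKddHat (-1))) *
            (((kummerCoreχq p i j hj).toKummerDataOfSection s hs hsec hsY hsYdd).etaleThetaDataOfClass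
              (etaDdχq p i j hj *
                (ThetaSetting.modelχq p i j hj).inflTheta (ThetaSetting.modelχq p i j hj).GtpYdd
                  (kummerCoreχq p i j hj).logUdd ^ m)).etaDd) ↔ j = 2 ∧ Even i := by
  constructor
  · rintro ⟨m, h15, hdeck⟩
    obtain ⟨hj2, rfl⟩ := (prop15iii_etaDdTwistPow_iff p i j hj s hs hsec hsY hsYdd hC m).mp h15
    have hm := (hdeck_etaDdTwistPow_iff_odd p i j hj hC s hs hsec hsY hsYdd (i - 1)).mp hdeck
    refine ⟨hj2, ?_⟩
    obtain ⟨r, hr⟩ := hm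
    exact ⟨r + 1, by omega⟩
  · rintro ⟨rfl, hi⟩
    have hm : Odd (i - 1) := by
      obtain ⟨r, hr⟩ := hi
      exact ⟨r - 1, by omega⟩
    exact ⟨i - 1, prop15iii_etaDdTwistPow_line p i s hs hsec hsY hsYdd hC,
      hdeck_etaDdTwistPow_of_odd p i 2 hj hC s hs hsec hsY hsYdd hm⟩

end OfSection

/-! ### The JOINT instances on the line `j = 2` -/

/-- **JOINT INSTANCE for every EVEN `i` (census form)**: at `modelχq p i 2` (every `p`, every `Compat` witness) the twisted
étale-theta datum `E(η_{i−1})` over the `inr`-section Kummer datum satisfies the typed Prop. 1.5 (iii) `Z`-law ((B)), the inversion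
clauses `InvClauses` for the re-centred inversion `ι_{1−i} = Inn(σ₀^{1−i}) ∘ ι` (an `IsInversionAut`, with a theta companion; (C)),
AND the class-level deck-sign clause (P14ii-cl) — the full binder set at ONE datum (gen 10's p505869 = `i = 2`).
[cite: MochizukiEtTh2009, Prop 1.5 (iii) p.23] -/
theorem exists_prop15iii_invClauses_hdeck_modelχq_line (hi : Even i) (hC : (ThetaSetting.modelχq p i 2 even_two).Compat) :
    haveI := hC.GtpYdd_normal
    ∃ (E : (ThetaSetting.modelχq p i 2 even_two).EtaleThetaData)
      (ι : (ThetaSetting.modelχq p i 2 even_two).PiTemp ≃ₜ* (ThetaSetting.modelχq p i 2 even_two).PiTemp)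
      (hι : (ThetaSetting.modelχq p i 2 even_two).IsInversionAut ι) (cι : ThetaSetting.ThetaCompanion ι),
      E.etaDd = etaDdχq p i 2 even_two *
        (ThetaSetting.modelχq p i 2 even_two).inflTheta (ThetaSetting.modelχq p i 2 even_two).GtpYdd
          (kummerCoreχq p i 2 even_two).logUdd ^ (i - 1) ∧
      ThetaSetting.Prop15iii E hC ∧ ThetaSetting.InvClauses E hι cι ∧
      ∀ ε : PiTpχq p i 2, ε ∈ (ThetaSetting.modelχq p i 2 even_two).GtpY → ε ∉ (ThetaSetting.modelχq p i 2 even_two).GtpYdd →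
        ContH1.conj (ThetaSetting.modelχq p i 2 even_two).toTheta (ThetaSetting.modelχq p i 2 even_two).DeltaTheta ε E.etaDd =
          (ThetaSetting.modelχq p i 2 even_two).inflTheta (ThetaSetting.modelχq p i 2 even_two).GtpYdd
            (E.kumYdd (E.toKddHat (-1))) * E.etaDd := by
  have hm : Odd (i - 1) := by
    obtain ⟨r, hr⟩ := hi
    exact ⟨r - 1, by omega⟩
  exact ⟨_, _, isInversionAut_inversionχq_recentredPow p i 2 even_two (1 - i),
    (nonempty_thetaCompanion_inversionχq_recentredPow p i 2 even_two (1 - i)).some, rfl,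
    prop15iii_etaDdTwistPow_line p i SemidirectProduct.inr (continuous_inrχq p i 2) (fun _ => rfl)
      (map_inr_GK_le_GtpY_modelχq' p i 2 even_two) (map_inr_GKdd_le_GtpYdd_modelχq' p i 2 even_two) hC,
    invClauses_etaDdTwistPow_recentredLine p i hC _ SemidirectProduct.inr (continuous_inrχq p i 2) (fun _ => rfl)
      (map_inr_GK_le_GtpY_modelχq' p i 2 even_two) (map_inr_GKdd_le_GtpYdd_modelχq' p i 2 even_two),
    hdeck_etaDdTwistPow_of_odd p i 2 even_two hC SemidirectProduct.inr (continuous_inrχq p i 2) (fun _ => rfl)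
      (map_inr_GK_le_GtpY_modelχq' p i 2 even_two) (map_inr_GKdd_le_GtpYdd_modelχq' p i 2 even_two) hm⟩

/-- **For EVERY `i`: {Prop. 1.5 (iii) `Z`-law ∧ inversion clauses} jointly at `modelχq p i 2`** for `E(η_{i−1})` and `ι_{1−i}`
(the deck-sign clause joins iff `i` is even). [cite: MochizukiEtTh2009, Prop 1.5 (iii) p.23] -/
theorem exists_prop15iii_invClauses_modelχq_line (hC : (ThetaSetting.modelχq p i 2 even_two).Compat) :
    ∃ (E : (ThetaSetting.modelχq p i 2 even_two).EtaleThetaData)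
      (ι : (ThetaSetting.modelχq p i 2 even_two).PiTemp ≃ₜ* (ThetaSetting.modelχq p i 2 even_two).PiTemp)
      (hι : (ThetaSetting.modelχq p i 2 even_two).IsInversionAut ι) (cι : ThetaSetting.ThetaCompanion ι),
      E.etaDd = etaDdχq p i 2 even_two *
        (ThetaSetting.modelχq p i 2 even_two).inflTheta (ThetaSetting.modelχq p i 2 even_two).GtpYdd
          (kummerCoreχq p i 2 even_two).logUdd ^ (i - 1) ∧
      ThetaSetting.Prop15iii E hC ∧ ThetaSetting.InvClauses E hι cι :=
  ⟨_, _, isInversionAut_inversionχq_recentredPow p i 2 even_two (1 - i),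
    (nonempty_thetaCompanion_inversionχq_recentredPow p i 2 even_two (1 - i)).some, rfl,
    prop15iii_etaDdTwistPow_line p i SemidirectProduct.inr (continuous_inrχq p i 2) (fun _ => rfl)
      (map_inr_GK_le_GtpY_modelχq' p i 2 even_two) (map_inr_GKdd_le_GtpYdd_modelχq' p i 2 even_two) hC,
    invClauses_etaDdTwistPow_recentredLine p i hC _ SemidirectProduct.inr (continuous_inrχq p i 2) (fun _ => rfl)
      (map_inr_GK_le_GtpY_modelχq' p i 2 even_two) (map_inr_GKdd_le_GtpYdd_modelχq' p i 2 even_two)⟩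

/-- **Root-level census form**: for every EVEN `i` the stage-2 theta SETTING of record `modelχq p i 2` (an `IsEtThOrigin` setting
with `Compat`) carries an étale-theta datum, an inversion automorphism and a theta companion for which the typed Prop. 1.5 (iii)
`Z`-law, the inversion clauses AND the deck-sign clause (P14ii-cl) hold JOINTLY. [cite: MochizukiEtTh2009, Prop 1.5 (iii) p.23] -/
theorem _root_.Literature.AnabelianGeometry.EtaleTheta.ThetaSetting.exists_isEtThOrigin_prop15iii_invClauses_hdeck_line
    (hi : Even i) :
    ∃ (D : ThetaSetting p) (hC : D.Compat) (E : D.EtaleThetaData) (ι : D.PiTemp ≃ₜ* D.PiTemp) (hι : D.IsInversionAut ι)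
      (cι : ThetaSetting.ThetaCompanion ι), D = ThetaSetting.modelχq p i 2 even_two ∧ D.IsEtThOrigin ∧
      ThetaSetting.Prop15iii E hC ∧ ThetaSetting.InvClauses E hι cι ∧
      haveI := hC.GtpYdd_normal
      ∀ ε : D.PiTemp, ε ∈ D.GtpY → ε ∉ D.GtpYdd →
        ContH1.conj D.toTheta D.DeltaTheta ε E.etaDd = D.inflTheta D.GtpYdd (E.kumYdd (E.toKddHat (-1))) * E.etaDd := by
  obtain ⟨E, ι, hι, cι, -, h15, hinv, hdeck⟩ :=
    exists_prop15iii_invClauses_hdeck_modelχq_line p i hi (ThetaSetting.modelχq_sec2Hyps p i 2 even_two).compat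
  exact ⟨_, _, E, ι, hι, cι, rfl, ThetaSetting.modelχq_isEtThOrigin p i 2 even_two, h15, hinv, hdeck⟩

end Literature.AnabelianGeometry.EtaleTheta.SettingModel

end
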